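import Mathlib.Analysis.Complex.CauchyIntegral
import Mathlib.Analysis.Complex.Isometry
import Mathlib.Analysis.SpecialFunctions.PolarCoord
import Mathlib.Analysis.SpecialFunctions.Integrals.Basic
import Mathlib.MeasureTheory.Integral.CircleIntegral
import Mathlib.Analysis.Calculus.FDeriv.Measurable
import Mathlib.MeasureTheory.Function.Jacobian
import Mathlib.MeasureTheory.Integral.MeanInequalities
import Mathlib.MeasureTheory.Measure.Haar.InnerProductSpace
import Mathlib.RingTheory.Complex
import HarnessLib

/-!
# The length–area argument: short crosscuts of a conformal map of the disc (Wolff's lemma)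

Trunk T-STOCH support (complex analysis). This is the analytic input of Carathéodory's extension
theorem for conformal maps onto Jordan domains
(`Literature/Probability/RandomPlanarGeometry/ConformalMap.lean`,
`Literature.Probability.RandomPlanarGeometry.JordanDomain.exists_continuousOn_extension`; Pommerenke, *Boundary Behaviour of Conformal
Maps* (1992), Thm. 2.6, whose proof rests on the length–area Prop. 2.2; Garnett–Marshall,
*Harmonic Measure* (2005), Lemma I.3.2 and Thm. I.3.1). Everything here is proved.

Let `f` be holomorphic and injective on the unit disc `𝔻` with image of finite area `A`, and
`‖ζ‖ = 1`. For `r > 0` the circle `{|w - ζ| = r}` is parametrised in the rotated frame by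
`Literature.LengthArea.cpt ζ r t = ζ - ζ r e^{it}`, `t ∈ (-π, π]`, and meets `𝔻` exactly for
`|t| < arccos (r / 2)` (`mem_ball_cpt_iff_abs_lt`). Writing `Λ(r) = ∫ ‖f' (cpt ζ r t)‖ dt`
(integrand extended by `0` off the disc, `angLen`), the crosscut `f (𝔻 ∩ {|w - ζ| = r})` has
length `r Λ(r)`, and

* `lintegral_angSq_eq_volume`: `∫_{r>0} r ∫ ‖f'‖² dt dr = A` (polar coordinates about `ζ` and the
  area formula `A = ∫∫_𝔻 ‖f'‖²`, `volume_image_ball_eq_lintegral`, from Mathlib's change of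
  variables `lintegral_image_eq_lintegral_abs_det_fderiv_mul` with Jacobian `‖f'‖²`);
* `angLen_sq_le`: `Λ(r)² ≤ 2π ∫ ‖f'‖² dt` (Cauchy–Schwarz), hence
  `lintegral_angLen_sq_le`: `∫_{r>0} r Λ(r)² dr ≤ 2π A` — the **length–area inequality**
  `∫ ℓ(r)² dr / r ≤ 2π A`;
* `exists_mul_le_of_lintegral_ne_top`: pigeonhole on `(δ, √δ)` (where `∫ dr / r = ½ log (1/δ)`):
  for every `ε > 0` some `r ≤ ε` in `(0, 1)` has `r Λ(r) ≤ ε`;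
* `exists_tendsto_nhdsGT`, `exists_tendsto_nhdsLT`, `dist_le_of_tendsto…`: a `C¹` curve on an
  open interval with `∫ ‖c'‖ < ∞` has endpoints, within the length of every point of the curve;
* `exists_short_crosscut` (**Wolff's lemma**, Pommerenke Prop. 2.2): for every `ε > 0` there
  is `r ∈ (0, 1)`, `r ≤ ε`, such that the crosscut of `f (𝔻)` at distance `r` from `ζ` has
  endpoints `a`, `b` with `dist a b ≤ ε` and stays within `ε` of `a`
  (`exists_short_crosscut_of_isBounded`: the same for a bounded image).

Mathlib has all the measure theory used (`Complex.lintegral_comp_polarCoord_symm`,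
`lintegral_prod`, `ENNReal.lintegral_mul_le_Lp_mul_Lq`, `tendsto_setLIntegral_zero`,
`integral_inv_of_pos`, `LinearIsometryEquiv.measurePreserving`) but neither the area formula for
holomorphic maps nor any length–area statement (searched `length.?area`, `crosscut`, `Wolff`).

## References

* Ch. Pommerenke, *Boundary Behaviour of Conformal Maps*, Springer (1992), Prop. 2.2, Thm. 2.6.
* J. B. Garnett, D. E. Marshall, *Harmonic Measure*, CUP (2005), Lemma I.3.2, Thm. I.3.1.
-/

noncomputable section

open Set Filter Metric Topology MeasureTheory Complex Real
open scoped ENNReal NNReal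

namespace Literature.Analysis.Complex

namespace LengthArea

/-! ### The Jacobian of a holomorphic map is `‖f'‖²` -/

/-- The real Jacobian determinant of multiplication by `c` on `ℂ` is `‖c‖ ^ 2`. [folklore] -/
theorem det_restrictScalars_smulRight (c : ℂ) :
    ((ContinuousLinearMap.smulRight (1 : ℂ →L[ℂ] ℂ) c).restrictScalars ℝ).det = ‖c‖ ^ 2 := by
  have h : (((ContinuousLinearMap.smulRight (1 : ℂ →L[ℂ] ℂ) c).restrictScalars ℝ :
      ℂ →L[ℝ] ℂ) : ℂ →ₗ[ℝ] ℂ) = Algebra.lmul ℝ ℂ c := by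
    ext w
    simp [mul_comm]
  rw [ContinuousLinearMap.det, h]
  change LinearMap.det (Algebra.lmul ℝ ℂ c) = _
  rw [← Algebra.norm_apply, Algebra.norm_complex_apply, normSq_eq_norm_sq]

variable {f : ℂ → ℂ}

/-- **Area formula** for an injective holomorphic map of the unit disc:
`area (f (𝔻)) = ∫∫_𝔻 ‖f'‖²`. [folklore] -/
theorem volume_image_ball_eq_lintegral (hf : DifferentiableOn ℂ f (ball 0 1))
    (hinj : InjOn f (ball 0 1)) :
    volume (f '' ball 0 1) = ∫⁻ w in ball (0 : ℂ) 1, ENNReal.ofReal (‖deriv f w‖ ^ 2) := by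
  have hd : ∀ w ∈ ball (0 : ℂ) 1, HasFDerivWithinAt f
      ((ContinuousLinearMap.smulRight (1 : ℂ →L[ℂ] ℂ) (deriv f w)).restrictScalars ℝ)
      (ball 0 1) w := fun w hw ↦
    ((hf.differentiableAt (isOpen_ball.mem_nhds hw)).hasDerivAt.hasFDerivAt.restrictScalars ℝ)
      |>.hasFDerivWithinAt
  have := lintegral_image_eq_lintegral_abs_det_fderiv_mul volume measurableSet_ball hd hinj
    (fun _ ↦ 1)
  simp only [mul_one, lintegral_one, Measure.restrict_apply_univ] at this
  rw [this]
  refine setLIntegral_congr_fun measurableSet_ball fun w _ ↦ ?_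
  rw [det_restrictScalars_smulRight, abs_of_nonneg (by positivity)]

/-! ### Polar coordinates about a boundary point -/

/-- The point at angle `t` on the circle of radius `r` about `ζ`, in the frame rotated by `-ζ`:
`cpt ζ r t = ζ - ζ r e^{it}` (for `‖ζ‖ = 1` and small `r`, the angles `|t| < arccos (r/2)` are
exactly those for which the point lies in the unit disc). [folklore] -/
def cpt (ζ : ℂ) (r t : ℝ) : ℂ := ζ - ζ * (r * exp (t * I))

/-- Mathlib's inverse polar coordinates in exponential form: `(r, t) ↦ r e^{it}`. [folklore] -/
theorem polarCoord_symm_eq (p : ℝ × ℝ) : Complex.polarCoord.symm p = p.1 * exp (p.2 * I) := by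
  rw [Complex.polarCoord_symm_apply, Complex.exp_mul_I, ← ofReal_cos, ← ofReal_sin]

variable {ζ : ℂ}

/-- The affine map `u ↦ ζ - ζ u` (`‖ζ‖ = 1`) preserves Lebesgue measure on `ℂ`. [folklore] -/
theorem measurePreserving_sub_mul (hζ : ‖ζ‖ = 1) :
    MeasurePreserving (fun u : ℂ ↦ ζ - ζ * u) volume volume := by
  set a : Circle := ⟨-ζ, by simp [Submonoid.unitSphere, hζ]⟩ with ha
  have h1 : MeasurePreserving (rotation a) volume volume := (rotation a).measurePreserving
  have h2 := measurePreserving_add_left (volume : Measure ℂ) ζ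
  have h := h2.comp h1
  have heq : ((fun x : ℂ ↦ ζ + x) ∘ (rotation a)) = fun u : ℂ ↦ ζ - ζ * u := by
    ext u
    simp [rotation_apply, ha, sub_eq_add_neg]
  rwa [heq] at h

/-- The affine map `u ↦ ζ - ζ u` (`‖ζ‖ = 1`) as a homeomorphism of `ℂ`. [folklore] -/
def subMulHomeomorph (hζ : ‖ζ‖ = 1) : ℂ ≃ₜ ℂ :=
  (Homeomorph.mulLeft₀ (-ζ) (by rw [neg_ne_zero]; rintro rfl; simp at hζ)).trans
    (Homeomorph.addLeft ζ)

/-- `subMulHomeomorph hζ u = ζ - ζ u`. [folklore] -/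
theorem subMulHomeomorph_apply (hζ : ‖ζ‖ = 1) (u : ℂ) : subMulHomeomorph hζ u = ζ - ζ * u := by
  simp [subMulHomeomorph, sub_eq_add_neg]

/-- Change of variables `w = ζ - ζ u` in a Lebesgue integral over `ℂ`. [folklore] -/
theorem lintegral_comp_sub_mul (hζ : ‖ζ‖ = 1) (G : ℂ → ℝ≥0∞) :
    ∫⁻ u, G (ζ - ζ * u) = ∫⁻ w, G w := by
  have hemb : MeasurableEmbedding (fun u : ℂ ↦ ζ - ζ * u) := by
    have := (subMulHomeomorph hζ).toMeasurableEquiv.measurableEmbedding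
    convert this using 1
    ext u
    exact (subMulHomeomorph_apply hζ u).symm
  exact (measurePreserving_sub_mul hζ).lintegral_comp_emb hemb G

/-- **Polar coordinates about `ζ`**: `∫∫ G = ∫_{r > 0} ∫_{t ∈ (-π, π)} r G (ζ - ζ r e^{it})`,
as an integral over `polarCoord.target = (0, ∞) × (-π, π)`. [folklore] -/
theorem lintegral_eq_lintegral_polar (hζ : ‖ζ‖ = 1) (G : ℂ → ℝ≥0∞) :
    ∫⁻ w, G w = ∫⁻ p in polarCoord.target, ENNReal.ofReal p.1 * G (cpt ζ p.1 p.2) := by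
  rw [← lintegral_comp_sub_mul hζ G, ← Complex.lintegral_comp_polarCoord_symm]
  simp only [polarCoord_symm_eq, smul_eq_mul, cpt]

/-- Tonelli on `polarCoord.target = (0, ∞) × (-π, π)`. [folklore] -/
theorem lintegral_polarCoord_target_eq {F : ℝ × ℝ → ℝ≥0∞} (hF : Measurable F) :
    ∫⁻ p in polarCoord.target, F p = ∫⁻ r in Ioi (0 : ℝ), ∫⁻ t in Ioo (-π) π, F (r, t) := by
  rw [show polarCoord.target = Ioi (0 : ℝ) ×ˢ Ioo (-π) π from rfl, Measure.volume_eq_prod,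
    ← Measure.prod_restrict, lintegral_prod _ hF.aemeasurable]

/-! ### The Dirichlet integral in polar coordinates -/

/-- `‖f'‖²` on the unit disc (extended by `0`), as an `ℝ≥0∞`-valued function. [folklore] -/
def sqDer (f : ℂ → ℂ) : ℂ → ℝ≥0∞ :=
  (ball (0 : ℂ) 1).indicator fun w ↦ ENNReal.ofReal (‖deriv f w‖ ^ 2)

/-- `‖f'‖` on the unit disc (extended by `0`), as an `ℝ≥0∞`-valued function. [folklore] -/
def der (f : ℂ → ℂ) : ℂ → ℝ≥0∞ :=
  (ball (0 : ℂ) 1).indicator fun w ↦ ENNReal.ofReal ‖deriv f w‖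

/-- `der f ^ 2 = sqDer f` pointwise. [folklore] -/
theorem der_sq (f : ℂ → ℂ) (w : ℂ) : der f w ^ 2 = sqDer f w := by
  by_cases hw : w ∈ ball (0 : ℂ) 1
  · simp [der, sqDer, hw, ENNReal.ofReal_pow (norm_nonneg _)]
  · simp [der, sqDer, hw]

/-- `sqDer f` is measurable (`deriv f` is measurable). [folklore] -/
theorem measurable_sqDer (f : ℂ → ℂ) : Measurable (sqDer f) :=
  (((measurable_deriv f).norm.pow_const 2).ennreal_ofReal).indicator measurableSet_ball

/-- `der f` is measurable (`deriv f` is measurable). [folklore] -/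
theorem measurable_der (f : ℂ → ℂ) : Measurable (der f) :=
  ((measurable_deriv f).norm.ennreal_ofReal).indicator measurableSet_ball

/-- `(r, t) ↦ cpt ζ r t` is continuous. [folklore] -/
theorem continuous_cpt_uncurry (ζ : ℂ) : Continuous fun p : ℝ × ℝ ↦ cpt ζ p.1 p.2 := by
  unfold cpt; fun_prop

/-- `t ↦ cpt ζ r t` is continuous. [folklore] -/
theorem continuous_cpt (ζ : ℂ) (r : ℝ) : Continuous (cpt ζ r) := by
  unfold cpt; fun_prop

/-- The angular integral `∫_{-π}^{π} ‖f'(ζ - ζ r e^{it})‖² dt` (integrand `0` off the disc). [folklore] -/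
def angSq (f : ℂ → ℂ) (ζ : ℂ) (r : ℝ) : ℝ≥0∞ :=
  ∫⁻ t in Ioo (-π) π, sqDer f (cpt ζ r t)

/-- The angular integral `∫_{-π}^{π} ‖f'(ζ - ζ r e^{it})‖ dt` (integrand `0` off the disc); the
crosscut `𝔻 ∩ {|w - ζ| = r}` has length `r * angLen f ζ r`. [folklore] -/
def angLen (f : ℂ → ℂ) (ζ : ℂ) (r : ℝ) : ℝ≥0∞ :=
  ∫⁻ t in Ioo (-π) π, der f (cpt ζ r t)

/-- **Area in polar coordinates**: `∫_{r>0} r ∫ ‖f'‖² dt dr = area f(𝔻)` for `f` injective and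
holomorphic on the disc. [folklore] -/
theorem lintegral_angSq_eq_volume (hf : DifferentiableOn ℂ f (ball 0 1))
    (hinj : InjOn f (ball 0 1)) (hζ : ‖ζ‖ = 1) :
    ∫⁻ r in Ioi (0 : ℝ), ENNReal.ofReal r * angSq f ζ r = volume (f '' ball 0 1) := by
  rw [volume_image_ball_eq_lintegral hf hinj, ← lintegral_indicator measurableSet_ball,
    show (fun w ↦ (ball (0 : ℂ) 1).indicator (fun w ↦ ENNReal.ofReal (‖deriv f w‖ ^ 2)) w)
      = sqDer f from rfl,
    lintegral_eq_lintegral_polar hζ, lintegral_polarCoord_target_eq]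
  · refine setLIntegral_congr_fun measurableSet_Ioi fun r hr ↦ ?_
    rw [angSq, lintegral_const_mul' _ _ ENNReal.ofReal_ne_top]
  · exact measurable_fst.ennreal_ofReal.mul
      ((measurable_sqDer f).comp (continuous_cpt_uncurry ζ).measurable)

/-- **Cauchy–Schwarz** for the angular integrals: `(∫ ‖f'‖ dt)² ≤ 2π ∫ ‖f'‖² dt`. [folklore] -/
theorem angLen_sq_le (f : ℂ → ℂ) (ζ : ℂ) (r : ℝ) :
    angLen f ζ r ^ 2 ≤ ENNReal.ofReal (2 * π) * angSq f ζ r := by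
  set μ : Measure ℝ := volume.restrict (Ioo (-π) π) with hμ
  have hmeas : AEMeasurable (fun t ↦ der f (cpt ζ r t)) μ :=
    ((measurable_der f).comp (continuous_cpt ζ r).measurable).aemeasurable
  have h := ENNReal.lintegral_mul_le_Lp_mul_Lq μ Real.HolderConjugate.two_two hmeas
    (g := fun _ ↦ 1) aemeasurable_const
  simp only [Pi.mul_apply, mul_one, lintegral_const, ENNReal.rpow_two, one_pow, one_mul] at h
  have hvol : μ univ = ENNReal.ofReal (2 * π) := by
    rw [hμ, Measure.restrict_apply_univ, Real.volume_Ioo]; ring_nf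
  rw [hvol] at h
  have hsq : ∫⁻ a, der f (cpt ζ r a) ^ 2 ∂μ = angSq f ζ r := by
    simp only [der_sq]; rfl
  rw [hsq] at h
  calc angLen f ζ r ^ 2 = (∫⁻ a, der f (cpt ζ r a) ∂μ) ^ 2 := rfl
    _ ≤ (angSq f ζ r ^ (1 / 2 : ℝ) * ENNReal.ofReal (2 * π) ^ (1 / 2 : ℝ)) ^ 2 := by
      gcongr
    _ = ENNReal.ofReal (2 * π) * angSq f ζ r := by
      rw [← ENNReal.mul_rpow_of_nonneg _ _ (by norm_num : (0 : ℝ) ≤ 1 / 2), ← ENNReal.rpow_two,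
        ← ENNReal.rpow_mul]
      norm_num [mul_comm]

/-- **Length–area inequality**: `∫_{r>0} r (∫ ‖f'‖ dt)² dr ≤ 2π · area f(𝔻)`, i.e.
`∫ ℓ(r)² dr / r ≤ 2π A` for the length `ℓ(r) = r ∫ ‖f'‖ dt` of the crosscut at distance `r`
from `ζ`. Pommerenke, *Boundary Behaviour of Conformal Maps* (1992), Prop. 2.2 (the length–area
inequality); Garnett–Marshall, *Harmonic Measure* (2005), Lemma I.3.2. [cite: PommerenkeBBCM1992, Prop. 2.2] -/
theorem lintegral_angLen_sq_le (hf : DifferentiableOn ℂ f (ball 0 1))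
    (hinj : InjOn f (ball 0 1)) (hζ : ‖ζ‖ = 1) :
    ∫⁻ r in Ioi (0 : ℝ), ENNReal.ofReal r * angLen f ζ r ^ 2
      ≤ ENNReal.ofReal (2 * π) * volume (f '' ball 0 1) := by
  calc ∫⁻ r in Ioi (0 : ℝ), ENNReal.ofReal r * angLen f ζ r ^ 2
      ≤ ∫⁻ r in Ioi (0 : ℝ), ENNReal.ofReal (2 * π) * (ENNReal.ofReal r * angSq f ζ r) := by
        refine lintegral_mono fun r ↦ ?_
        rw [mul_left_comm]
        gcongr
        exact angLen_sq_le f ζ r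
    _ = ENNReal.ofReal (2 * π) * volume (f '' ball 0 1) := by
        rw [lintegral_const_mul' _ _ ENNReal.ofReal_ne_top, lintegral_angSq_eq_volume hf hinj hζ]

/-! ### Pigeonhole: a short crosscut at a small distance -/

/-- If `ε ≤ r X` then `ε² / r ≤ r X²` (`r > 0`), in `ℝ≥0∞`. [folklore] -/
theorem ofReal_sq_div_le {r ε : ℝ} (hr : 0 < r) (hε : 0 ≤ ε) {X : ℝ≥0∞}
    (h : ENNReal.ofReal ε ≤ ENNReal.ofReal r * X) :
    ENNReal.ofReal (ε ^ 2 / r) ≤ ENNReal.ofReal r * X ^ 2 := by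
  rcases eq_or_ne X ⊤ with rfl | hX
  · simp [ENNReal.mul_top, (ENNReal.ofReal_pos.2 hr).ne']
  · lift X to ℝ≥0 using hX
    have hx : (0 : ℝ) ≤ X := X.2
    rw [← ENNReal.ofReal_coe_nnreal, ← ENNReal.ofReal_mul hr.le,
      ENNReal.ofReal_le_ofReal_iff (by positivity)] at h
    rw [← ENNReal.ofReal_coe_nnreal, ← ENNReal.ofReal_pow hx, ← ENNReal.ofReal_mul hr.le,
      ENNReal.ofReal_le_ofReal_iff (by positivity), div_le_iff₀ hr]
    calc ε ^ 2 ≤ (r * X) ^ 2 := by gcongr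
      _ = r * (X : ℝ) ^ 2 * r := by ring

/-- `∫_{(δ, √δ)} ε² dr / r = ε² · ½ log (1/δ)` as a Lebesgue integral (`0 < δ < 1`). [folklore] -/
theorem lintegral_sq_div (ε : ℝ) {δ : ℝ} (hδ : 0 < δ) (hδ1 : δ < 1) :
    ∫⁻ r in Ioo δ (√δ), ENNReal.ofReal (ε ^ 2 / r) = ENNReal.ofReal (ε ^ 2 * (Real.log (1 / δ) / 2)) := by
  have hle : δ ≤ √δ := by
    rw [Real.le_sqrt hδ.le hδ.le, sq]
    exact mul_le_of_le_one_left hδ.le hδ1.le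
  have hcont : ContinuousOn (fun r : ℝ ↦ ε ^ 2 / r) (Icc δ (√δ)) :=
    continuousOn_const.div continuousOn_id fun r hr ↦ (hδ.trans_le hr.1).ne'
  have hint : IntegrableOn (fun r : ℝ ↦ ε ^ 2 / r) (Ioo δ (√δ)) :=
    (hcont.integrableOn_Icc).mono_set Ioo_subset_Icc_self
  rw [← ofReal_integral_eq_lintegral_ofReal hint]
  · congr 1
    have hlog : Real.log (√δ / δ) = Real.log (1 / δ) / 2 := by
      rw [Real.log_div (Real.sqrt_pos.2 hδ).ne' hδ.ne', Real.log_sqrt hδ.le, one_div, Real.log_inv]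
      ring
    rw [← integral_Ioc_eq_integral_Ioo, ← intervalIntegral.integral_of_le hle, ← hlog,
      ← integral_inv_of_pos hδ (hδ.trans_le hle), ← intervalIntegral.integral_const_mul]
    refine intervalIntegral.integral_congr fun r _ ↦ ?_
    simp [div_eq_mul_inv]
  · exact (ae_restrict_iff' measurableSet_Ioo).2 (Eventually.of_forall fun r hr ↦
      div_nonneg (sq_nonneg _) (hδ.trans hr.1).le)

/-- **Pigeonhole for the length–area inequality.** If `∫_{r>0} r Λ(r)² dr < ∞` then for every
`ε > 0` there is `r ∈ (0, 1)`, `r ≤ ε`, with `r Λ(r) ≤ ε`: apply the finiteness on the interval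
`(δ, √δ)`, where `∫ dr / r = ½ log (1/δ) → ∞`. [folklore] -/
theorem exists_mul_le_of_lintegral_ne_top {Λ : ℝ → ℝ≥0∞}
    (hK : ∫⁻ r in Ioi (0 : ℝ), ENNReal.ofReal r * Λ r ^ 2 ≠ ⊤) {ε : ℝ} (hε : 0 < ε) :
    ∃ r ∈ Ioo (0 : ℝ) 1, r ≤ ε ∧ ENNReal.ofReal r * Λ r ≤ ENNReal.ofReal ε := by
  set K := ∫⁻ r in Ioi (0 : ℝ), ENNReal.ofReal r * Λ r ^ 2 with hKdef
  by_contra hcon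
  push Not at hcon
  set δ : ℝ := min (ε ^ 2) (1 / 2) * Real.exp (-(2 * K.toReal / ε ^ 2)) with hδdef
  have hε2 : 0 < ε ^ 2 := by positivity
  have hmin : 0 < min (ε ^ 2) (1 / 2) := lt_min hε2 (by norm_num)
  have hδ : 0 < δ := mul_pos hmin (Real.exp_pos _)
  have hexp_le : Real.exp (-(2 * K.toReal / ε ^ 2)) ≤ 1 := by
    rw [Real.exp_le_one_iff, neg_nonpos]; positivity
  have hδε : δ ≤ ε ^ 2 :=
    (mul_le_of_le_one_right hmin.le hexp_le).trans (min_le_left _ _)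
  have hδ1 : δ < 1 :=
    (mul_le_of_le_one_right hmin.le hexp_le).trans_lt ((min_le_right _ _).trans_lt (by norm_num))
  have hlog : 2 * K.toReal / ε ^ 2 < Real.log (1 / δ) := by
    rw [one_div, Real.log_inv, hδdef, Real.log_mul hmin.ne' (Real.exp_pos _).ne', Real.log_exp]
    have : Real.log (min (ε ^ 2) (1 / 2)) < 0 := Real.log_neg hmin ((min_le_right _ _).trans_lt (by norm_num))
    linarith
  have hsqrt : √δ ≤ ε := by
    calc √δ ≤ √(ε ^ 2) := Real.sqrt_le_sqrt hδε
      _ = ε := Real.sqrt_sq hε.le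
  -- pointwise lower bound on `(δ, √δ)`
  have hs1 : √δ < 1 := by rw [Real.sqrt_lt' one_pos]; simpa using hδ1
  have hpt : ∀ r ∈ Ioo δ (√δ), ENNReal.ofReal (ε ^ 2 / r) ≤ ENNReal.ofReal r * Λ r ^ 2 := by
    intro r hr
    have hr0 : 0 < r := hδ.trans hr.1
    exact ofReal_sq_div_le hr0 hε.le (hcon r ⟨hr0, hr.2.trans hs1⟩ (hr.2.le.trans hsqrt)).le
  have hI := lintegral_sq_div ε hδ hδ1
  have h1 : ENNReal.ofReal (ε ^ 2 * (Real.log (1 / δ) / 2)) ≤ K := by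
    rw [← hI]
    calc ∫⁻ r in Ioo δ (√δ), ENNReal.ofReal (ε ^ 2 / r)
        ≤ ∫⁻ r in Ioo δ (√δ), ENNReal.ofReal r * Λ r ^ 2 := setLIntegral_mono' measurableSet_Ioo hpt
      _ ≤ K := lintegral_mono_set fun r hr ↦ (hδ.trans hr.1 : 0 < r)
  have hlog0 : 0 ≤ Real.log (1 / δ) := Real.log_nonneg (one_le_one_div hδ hδ1.le)
  have h2 : ε ^ 2 * (Real.log (1 / δ) / 2) ≤ K.toReal := by
    have := ENNReal.toReal_mono hK h1
    rwa [ENNReal.toReal_ofReal (by positivity)] at this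
  have h3 : K.toReal < ε ^ 2 * (Real.log (1 / δ) / 2) := by
    rw [div_lt_iff₀ hε2] at hlog
    linarith
  linarith

/-! ### Geometry of the circles about a boundary point -/

/-- `cpt ζ r t = ζ - ζ · circleMap 0 r t`. [folklore] -/
theorem cpt_eq_circleMap (ζ : ℂ) (r t : ℝ) : cpt ζ r t = ζ - ζ * circleMap 0 r t := by
  simp [cpt, circleMap]

/-- `cpt ζ r t` is at distance `|r|` from `ζ` (`‖ζ‖ = 1`). [folklore] -/
theorem norm_cpt_sub (hζ : ‖ζ‖ = 1) (r t : ℝ) : ‖cpt ζ r t - ζ‖ = |r| := by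
  simp [cpt, norm_exp_ofReal_mul_I, hζ]

/-- `‖ζ - ζ r e^{it}‖² = 1 - 2 r cos t + r²` for `‖ζ‖ = 1`. [folklore] -/
theorem norm_cpt_sq (hζ : ‖ζ‖ = 1) (r t : ℝ) : ‖cpt ζ r t‖ ^ 2 = 1 - 2 * r * Real.cos t + r ^ 2 := by
  have h : cpt ζ r t = ζ * ((1 - r * Real.cos t : ℝ) + (-(r * Real.sin t) : ℝ) * I) := by
    rw [cpt, Complex.exp_mul_I, ← ofReal_cos, ← ofReal_sin]
    push_cast
    ring
  rw [h, norm_mul, hζ, one_mul, ← normSq_eq_norm_sq, normSq_add_mul_I]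
  nlinarith [Real.sin_sq_add_cos_sq t]

/-- `ζ - ζ r e^{it} ∈ 𝔻 ↔ r / 2 < cos t` (`‖ζ‖ = 1`, `r > 0`). [folklore] -/
theorem mem_ball_cpt_iff (hζ : ‖ζ‖ = 1) {r : ℝ} (hr : 0 < r) (t : ℝ) :
    cpt ζ r t ∈ ball (0 : ℂ) 1 ↔ r / 2 < Real.cos t := by
  rw [mem_ball_zero_iff, ← sq_lt_one_iff₀ (norm_nonneg _), norm_cpt_sq hζ]
  constructor <;> intro h <;> nlinarith

/-- For `0 ≤ r ≤ 2` and `|t| ≤ π`: `r / 2 < cos t ↔ |t| < arccos (r / 2)`. [folklore] -/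
theorem div_two_lt_cos_iff {r t : ℝ} (hr : 0 ≤ r) (hr2 : r ≤ 2) (ht : |t| ≤ π) :
    r / 2 < Real.cos t ↔ |t| < arccos (r / 2) := by
  have hc : Real.cos (arccos (r / 2)) = r / 2 := Real.cos_arccos (by linarith) (by linarith)
  rw [← Real.cos_abs t]
  conv_lhs => rw [← hc]
  exact Real.strictAntiOn_cos.lt_iff_gt ⟨arccos_nonneg _, arccos_le_pi _⟩ ⟨abs_nonneg _, ht⟩

/-- For `‖ζ‖ = 1` and `0 < r ≤ 2`, the point `ζ - ζ r e^{it}` (`|t| ≤ π`) lies in the unit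
disc iff `|t| < arccos (r / 2)`. [folklore] -/
theorem mem_ball_cpt_iff_abs_lt (hζ : ‖ζ‖ = 1) {r : ℝ} (hr : 0 < r) (hr2 : r ≤ 2) {t : ℝ}
    (ht : |t| ≤ π) : cpt ζ r t ∈ ball (0 : ℂ) 1 ↔ |t| < arccos (r / 2) := by
  rw [mem_ball_cpt_iff hζ hr, div_two_lt_cos_iff hr.le hr2 ht]

/-- Every point at distance `r > 0` from `ζ` (`‖ζ‖ = 1`) is `ζ - ζ r e^{it}` for some
`t ∈ (-π, π]`. [folklore] -/
theorem exists_eq_cpt (hζ : ‖ζ‖ = 1) {r : ℝ} (hr : 0 < r) {w : ℂ} (hw : ‖w - ζ‖ = r) :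
    ∃ t ∈ Ioc (-π) π, w = cpt ζ r t := by
  have hζ0 : ζ ≠ 0 := by rintro rfl; simp at hζ
  set v : ℂ := -(w - ζ) / (ζ * r) with hv
  have hv1 : ‖v‖ = 1 := by
    rw [hv, norm_div, norm_neg, hw, norm_mul, hζ, one_mul, Complex.norm_real, Real.norm_eq_abs,
      abs_of_pos hr, div_self hr.ne']
  refine ⟨arg v, arg_mem_Ioc v, ?_⟩
  have hexp : exp (arg v * I) = v := by
    have h := norm_mul_exp_arg_mul_I v
    rwa [hv1, ofReal_one, one_mul] at h
  have hr' : (r : ℂ) ≠ 0 := ofReal_ne_zero.2 hr.ne'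
  rw [cpt, hexp, hv]
  field_simp
  ring

/-- Derivative of the circle parametrisation `t ↦ ζ - ζ r e^{it}`. [folklore] -/
theorem hasDerivAt_cpt (ζ : ℂ) (r t : ℝ) :
    HasDerivAt (cpt ζ r) (-(ζ * (circleMap 0 r t * I))) t := by
  have h := ((hasDerivAt_circleMap 0 r t).const_mul (-ζ)).const_add ζ
  have heq : (fun x ↦ ζ + -ζ * circleMap 0 r x) = cpt ζ r := by
    ext x; rw [cpt_eq_circleMap]; ring
  rw [heq] at h
  exact h.congr_deriv (by ring)

/-- The speed of `t ↦ ζ - ζ r e^{it}` is `r` (`‖ζ‖ = 1`, `r ≥ 0`). [folklore] -/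
theorem norm_deriv_cpt (hζ : ‖ζ‖ = 1) {r : ℝ} (hr : 0 ≤ r) (t : ℝ) :
    ‖-(ζ * (circleMap 0 r t * I))‖ = r := by
  simp [norm_circleMap_zero, hζ, abs_of_nonneg hr]

/-! ### Curves of finite length have endpoints -/

section Endpoints

variable {c c' : ℝ → ℂ} {a b : ℝ}

/-- `‖c t₂ - c t₁‖ ≤ ∫_{t₁}^{t₂} ‖c'‖` for a `C¹` curve on `(a, b) ⊇ [t₁, t₂]`. [folklore] -/
theorem enorm_sub_le_lintegral (hc : ∀ s ∈ Ioo a b, HasDerivAt c (c' s) s)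
    (hc' : ContinuousOn c' (Ioo a b)) {t₁ t₂ : ℝ} (h₁ : a < t₁) (h₁₂ : t₁ ≤ t₂) (h₂ : t₂ < b) :
    ‖c t₂ - c t₁‖ₑ ≤ ∫⁻ s in Ioc t₁ t₂, ‖c' s‖ₑ := by
  have hsub : Icc t₁ t₂ ⊆ Ioo a b := fun s hs ↦ ⟨h₁.trans_le hs.1, hs.2.trans_lt h₂⟩
  have hcont : ContinuousOn c' (uIcc t₁ t₂) := by
    rw [uIcc_of_le h₁₂]; exact hc'.mono hsub
  have hint : IntervalIntegrable c' volume t₁ t₂ := hcont.intervalIntegrable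
  have hftc := intervalIntegral.integral_eq_sub_of_hasDerivAt
    (fun s hs ↦ hc s (hsub (by rwa [uIcc_of_le h₁₂] at hs))) hint
  have hle : ‖c t₂ - c t₁‖ ≤ (∫⁻ s in Ioc t₁ t₂, ‖c' s‖ₑ).toReal := by
    rw [← hftc, ← integral_norm_eq_lintegral_enorm hint.1.aestronglyMeasurable,
      ← intervalIntegral.integral_of_le h₁₂]
    exact intervalIntegral.norm_integral_le_integral_norm h₁₂
  calc ‖c t₂ - c t₁‖ₑ = ENNReal.ofReal ‖c t₂ - c t₁‖ := (ofReal_norm _).symm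
    _ ≤ ENNReal.ofReal ((∫⁻ s in Ioc t₁ t₂, ‖c' s‖ₑ).toReal) := ENNReal.ofReal_le_ofReal hle
    _ ≤ ∫⁻ s in Ioc t₁ t₂, ‖c' s‖ₑ := ENNReal.ofReal_toReal_le

/-- A `C¹` curve on `(a, b)` with `∫_a^b ‖c'‖ < ∞` has a limit at `a⁺`. [folklore] -/
theorem exists_tendsto_nhdsGT (hab : a < b) (hc : ∀ s ∈ Ioo a b, HasDerivAt c (c' s) s)
    (hc' : ContinuousOn c' (Ioo a b)) (hL : ∫⁻ s in Ioo a b, ‖c' s‖ₑ ≠ ⊤) :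
    ∃ A, Tendsto c (𝓝[>] a) (𝓝 A) := by
  set g : ℝ → ℝ≥0∞ := (Ioo a b).indicator fun s ↦ ‖c' s‖ₑ with hg
  have hgL : ∫⁻ s, g s ≠ ⊤ := by rwa [hg, lintegral_indicator measurableSet_Ioo]
  have hvol : Tendsto (volume ∘ fun τ ↦ Ioo a τ) (𝓝[>] a) (𝓝 0) := by
    have h1 : Tendsto (fun τ : ℝ ↦ ENNReal.ofReal (τ - a)) (𝓝[>] a) (𝓝 0) := by
      have : Tendsto (fun τ : ℝ ↦ τ - a) (𝓝 a) (𝓝 (a - a)) := tendsto_id.sub_const a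
      rw [sub_self] at this
      simpa using (ENNReal.tendsto_ofReal this).mono_left nhdsWithin_le_nhds
    refine h1.congr fun τ ↦ ?_
    simp [Real.volume_Ioo]
  have htend := tendsto_setLIntegral_zero (μ := volume) hgL hvol
  have hbound : ∀ τ ≤ b, ∀ t₁ t₂, a < t₁ → t₁ ≤ t₂ → t₂ < τ →
      ‖c t₂ - c t₁‖ₑ ≤ ∫⁻ s in Ioo a τ, g s := by
    intro τ hτ t₁ t₂ h₁ h₁₂ h₂
    calc ‖c t₂ - c t₁‖ₑ ≤ ∫⁻ s in Ioc t₁ t₂, ‖c' s‖ₑ :=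
          enorm_sub_le_lintegral hc hc' h₁ h₁₂ (h₂.trans_le hτ)
      _ = ∫⁻ s in Ioc t₁ t₂, g s := by
          refine setLIntegral_congr_fun measurableSet_Ioc fun s hs ↦ ?_
          have hmem : s ∈ Ioo a b := ⟨h₁.trans hs.1, hs.2.trans_lt (h₂.trans_le hτ)⟩
          simp only [hg, Set.indicator_of_mem hmem]
      _ ≤ ∫⁻ s in Ioo a τ, g s := lintegral_mono_set fun s hs ↦ ⟨h₁.trans hs.1, hs.2.trans_lt h₂⟩
  have hC : Cauchy (map c (𝓝[>] a)) := by
    rw [Metric.cauchy_iff]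
    refine ⟨inferInstance, fun ε hε ↦ ?_⟩
    have hev : ∀ᶠ τ in 𝓝[>] a, ∫⁻ s in Ioo a τ, g s < ENNReal.ofReal ε :=
      htend (gt_mem_nhds (ENNReal.ofReal_pos.2 hε))
    obtain ⟨τ, hτε, hτa, hτb⟩ := (hev.and (Ioo_mem_nhdsGT hab)).exists
    refine ⟨c '' Ioo a τ, image_mem_map (Ioo_mem_nhdsGT hτa), ?_⟩
    rintro _ ⟨t₁, ht₁, rfl⟩ _ ⟨t₂, ht₂, rfl⟩
    wlog h : t₁ ≤ t₂ generalizing t₁ t₂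
    · rw [dist_comm]; exact this t₂ ht₂ t₁ ht₁ (le_of_not_ge h)
    rw [dist_comm, dist_eq_norm, ← ENNReal.ofReal_lt_ofReal_iff hε, ofReal_norm]
    exact (hbound τ hτb.le t₁ t₂ ht₁.1 h ht₂.2).trans_lt hτε
  obtain ⟨A, hA⟩ := CompleteSpace.complete hC
  exact ⟨A, hA⟩

/-- A `C¹` curve on `(a, b)` with `∫_a^b ‖c'‖ < ∞` has a limit at `b⁻`. [folklore] -/
theorem exists_tendsto_nhdsLT (hab : a < b) (hc : ∀ s ∈ Ioo a b, HasDerivAt c (c' s) s)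
    (hc' : ContinuousOn c' (Ioo a b)) (hL : ∫⁻ s in Ioo a b, ‖c' s‖ₑ ≠ ⊤) :
    ∃ B, Tendsto c (𝓝[<] b) (𝓝 B) := by
  set g : ℝ → ℝ≥0∞ := (Ioo a b).indicator fun s ↦ ‖c' s‖ₑ with hg
  have hgL : ∫⁻ s, g s ≠ ⊤ := by rwa [hg, lintegral_indicator measurableSet_Ioo]
  have hvol : Tendsto (volume ∘ fun τ ↦ Ioo τ b) (𝓝[<] b) (𝓝 0) := by
    have h1 : Tendsto (fun τ : ℝ ↦ ENNReal.ofReal (b - τ)) (𝓝[<] b) (𝓝 0) := by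
      have : Tendsto (fun τ : ℝ ↦ b - τ) (𝓝 b) (𝓝 (b - b)) := tendsto_const_nhds.sub tendsto_id
      rw [sub_self] at this
      simpa using (ENNReal.tendsto_ofReal this).mono_left nhdsWithin_le_nhds
    refine h1.congr fun τ ↦ ?_
    simp [Real.volume_Ioo]
  have htend := tendsto_setLIntegral_zero (μ := volume) hgL hvol
  have hbound : ∀ τ, a ≤ τ → ∀ t₁ t₂, τ < t₁ → t₁ ≤ t₂ → t₂ < b →
      ‖c t₂ - c t₁‖ₑ ≤ ∫⁻ s in Ioo τ b, g s := by
    intro τ hτ t₁ t₂ h₁ h₁₂ h₂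
    calc ‖c t₂ - c t₁‖ₑ ≤ ∫⁻ s in Ioc t₁ t₂, ‖c' s‖ₑ :=
          enorm_sub_le_lintegral hc hc' (hτ.trans_lt h₁) h₁₂ h₂
      _ = ∫⁻ s in Ioc t₁ t₂, g s := by
          refine setLIntegral_congr_fun measurableSet_Ioc fun s hs ↦ ?_
          have hmem : s ∈ Ioo a b := ⟨(hτ.trans_lt h₁).trans hs.1, hs.2.trans_lt h₂⟩
          simp only [hg, Set.indicator_of_mem hmem]
      _ ≤ ∫⁻ s in Ioo τ b, g s := lintegral_mono_set fun s hs ↦ ⟨h₁.trans hs.1, hs.2.trans_lt h₂⟩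
  have hC : Cauchy (map c (𝓝[<] b)) := by
    rw [Metric.cauchy_iff]
    refine ⟨inferInstance, fun ε hε ↦ ?_⟩
    have hev : ∀ᶠ τ in 𝓝[<] b, ∫⁻ s in Ioo τ b, g s < ENNReal.ofReal ε :=
      htend (gt_mem_nhds (ENNReal.ofReal_pos.2 hε))
    obtain ⟨τ, hτε, hτa, hτb⟩ := (hev.and (Ioo_mem_nhdsLT hab)).exists
    refine ⟨c '' Ioo τ b, image_mem_map (Ioo_mem_nhdsLT hτb), ?_⟩
    rintro _ ⟨t₁, ht₁, rfl⟩ _ ⟨t₂, ht₂, rfl⟩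
    wlog h : t₁ ≤ t₂ generalizing t₁ t₂
    · rw [dist_comm]; exact this t₂ ht₂ t₁ ht₁ (le_of_not_ge h)
    rw [dist_comm, dist_eq_norm, ← ENNReal.ofReal_lt_ofReal_iff hε, ofReal_norm]
    exact (hbound τ hτa.le t₁ t₂ ht₁.1 h ht₂.2).trans_lt hτε
  obtain ⟨B, hB⟩ := CompleteSpace.complete hC
  exact ⟨B, hB⟩

/-- Distance bounds by the total length: points of the curve, and its two endpoints, are within
`∫_a^b ‖c'‖` of each other. [folklore] -/
theorem dist_le_of_lintegral (hc : ∀ s ∈ Ioo a b, HasDerivAt c (c' s) s)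
    (hc' : ContinuousOn c' (Ioo a b)) (hL : ∫⁻ s in Ioo a b, ‖c' s‖ₑ ≠ ⊤)
    {t₁ t₂ : ℝ} (ht₁ : t₁ ∈ Ioo a b) (ht₂ : t₂ ∈ Ioo a b) :
    dist (c t₁) (c t₂) ≤ (∫⁻ s in Ioo a b, ‖c' s‖ₑ).toReal := by
  wlog h : t₁ ≤ t₂ generalizing t₁ t₂
  · rw [dist_comm]; exact this ht₂ ht₁ (le_of_not_ge h)
  rw [dist_comm, dist_eq_norm]
  have h1 : ‖c t₂ - c t₁‖ₑ ≤ ∫⁻ s in Ioo a b, ‖c' s‖ₑ :=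
    (enorm_sub_le_lintegral hc hc' ht₁.1 h ht₂.2).trans
      (lintegral_mono_set fun s hs ↦ ⟨ht₁.1.trans hs.1, hs.2.trans_lt ht₂.2⟩)
  rw [← ofReal_norm] at h1
  exact (ENNReal.ofReal_le_iff_le_toReal hL).1 h1

/-- Every point of a curve of finite length `L` is within `L` of its initial endpoint. [folklore] -/
theorem dist_le_of_tendsto (hc : ∀ s ∈ Ioo a b, HasDerivAt c (c' s) s)
    (hc' : ContinuousOn c' (Ioo a b)) (hL : ∫⁻ s in Ioo a b, ‖c' s‖ₑ ≠ ⊤)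
    {A : ℂ} (hA : Tendsto c (𝓝[>] a) (𝓝 A)) (hab : a < b) {t : ℝ} (ht : t ∈ Ioo a b) :
    dist (c t) A ≤ (∫⁻ s in Ioo a b, ‖c' s‖ₑ).toReal := by
  have hlim : Tendsto (fun t₁ ↦ dist (c t) (c t₁)) (𝓝[>] a) (𝓝 (dist (c t) A)) :=
    tendsto_const_nhds.dist hA
  refine le_of_tendsto hlim ?_
  filter_upwards [Ioo_mem_nhdsGT hab] with t₁ ht₁
  exact dist_le_of_lintegral hc hc' hL ht ht₁

/-- The two endpoints of a curve of finite length `L` are within `L` of each other. [folklore] -/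
theorem dist_le_of_tendsto_of_tendsto (hc : ∀ s ∈ Ioo a b, HasDerivAt c (c' s) s)
    (hc' : ContinuousOn c' (Ioo a b)) (hL : ∫⁻ s in Ioo a b, ‖c' s‖ₑ ≠ ⊤)
    {A B : ℂ} (hA : Tendsto c (𝓝[>] a) (𝓝 A)) (hB : Tendsto c (𝓝[<] b) (𝓝 B)) (hab : a < b) :
    dist A B ≤ (∫⁻ s in Ioo a b, ‖c' s‖ₑ).toReal := by
  have hlim : Tendsto (fun t ↦ dist A (c t)) (𝓝[<] b) (𝓝 (dist A B)) :=
    tendsto_const_nhds.dist hB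
  refine le_of_tendsto hlim ?_
  filter_upwards [Ioo_mem_nhdsLT hab] with t ht
  rw [dist_comm]
  exact dist_le_of_tendsto hc hc' hL hA hab ht

end Endpoints

/-! ### Short crosscuts -/

/-- **The length–area lemma (Wolff's lemma) for a conformal map of the disc.** Let `f` be
holomorphic and injective on the unit disc with image of finite area, `‖ζ‖ = 1` and `ε > 0`.
Then there is a radius `r ∈ (0, 1)`, `r ≤ ε`, such that the crosscut `f (𝔻 ∩ {|w - ζ| = r})`,
parametrised by `t ↦ f (ζ - ζ r e^{it})`, `|t| < arccos (r/2)`, has endpoints `a`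
(at `t → -arccos (r/2)⁺`) and `b` (at `t → arccos (r/2)⁻`), stays within distance `ε` of `a`,
and `dist a b ≤ ε` (indeed its length is at most `ε`). Pommerenke, *Boundary Behaviour of
Conformal Maps* (1992), Prop. 2.2 (length–area); Garnett–Marshall, *Harmonic Measure* (2005),
Lemma I.3.2. [cite: PommerenkeBBCM1992, Prop. 2.2] -/
theorem exists_short_crosscut (hf : DifferentiableOn ℂ f (ball 0 1)) (hinj : InjOn f (ball 0 1))
    (hA : volume (f '' ball 0 1) ≠ ⊤) (hζ : ‖ζ‖ = 1) {ε : ℝ} (hε : 0 < ε) :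
    ∃ r ∈ Ioo (0 : ℝ) 1, r ≤ ε ∧ ∃ a b : ℂ,
      Tendsto (fun t ↦ f (cpt ζ r t)) (𝓝[>] (-arccos (r / 2))) (𝓝 a) ∧
      Tendsto (fun t ↦ f (cpt ζ r t)) (𝓝[<] (arccos (r / 2))) (𝓝 b) ∧
      (∀ t ∈ Ioo (-arccos (r / 2)) (arccos (r / 2)), dist (f (cpt ζ r t)) a ≤ ε) ∧
      dist a b ≤ ε := by
  -- finiteness of `∫ r ℓ(r)² dr` and the pigeonhole
  have hK : ∫⁻ r in Ioi (0 : ℝ), ENNReal.ofReal r * angLen f ζ r ^ 2 ≠ ⊤ :=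
    ne_top_of_le_ne_top (ENNReal.mul_ne_top ENNReal.ofReal_ne_top hA)
      (lintegral_angLen_sq_le hf hinj hζ)
  obtain ⟨r, ⟨hr0, hr1⟩, hrε, hlen⟩ := exists_mul_le_of_lintegral_ne_top hK hε
  set α : ℝ := arccos (r / 2) with hα
  have hαpos : 0 < α := arccos_pos.2 (by linarith)
  have hαpi : α ≤ π := arccos_le_pi _
  have hmem : ∀ s ∈ Ioo (-α) α, cpt ζ r s ∈ ball (0 : ℂ) 1 := fun s hs ↦ by
    have habs : |s| < α := abs_lt.2 hs
    exact (mem_ball_cpt_iff_abs_lt hζ hr0 (by linarith) (habs.le.trans hαpi)).2 habs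
  -- the crosscut as a `C¹` curve of length `≤ ε`
  set c : ℝ → ℂ := fun t ↦ f (cpt ζ r t) with hc
  set c' : ℝ → ℂ := fun t ↦ deriv f (cpt ζ r t) * -(ζ * (circleMap 0 r t * I)) with hc'
  have hderiv : ∀ s ∈ Ioo (-α) α, HasDerivAt c (c' s) s := fun s hs ↦
    ((hf.differentiableAt (isOpen_ball.mem_nhds (hmem s hs))).hasDerivAt.comp s
      (hasDerivAt_cpt ζ r s))
  have hcont : ContinuousOn c' (Ioo (-α) α) := by
    have hd : ContinuousOn (deriv f) (ball (0 : ℂ) 1) :=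
      ((hf.analyticOnNhd isOpen_ball).deriv).continuousOn
    refine (hd.comp (continuous_cpt ζ r).continuousOn hmem).mul ?_
    fun_prop
  have hL : ∫⁻ s in Ioo (-α) α, ‖c' s‖ₑ ≤ ENNReal.ofReal ε := by
    calc ∫⁻ s in Ioo (-α) α, ‖c' s‖ₑ = ∫⁻ s in Ioo (-α) α, der f (cpt ζ r s) * ENNReal.ofReal r := by
          refine setLIntegral_congr_fun measurableSet_Ioo fun s hs ↦ ?_
          rw [hc', enorm_mul, der, indicator_of_mem (hmem s hs), ofReal_norm,
            ← ofReal_norm (-(ζ * (circleMap 0 r s * I))), norm_deriv_cpt hζ hr0.le]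
      _ = (∫⁻ s in Ioo (-α) α, der f (cpt ζ r s)) * ENNReal.ofReal r :=
          lintegral_mul_const' _ _ ENNReal.ofReal_ne_top
      _ ≤ angLen f ζ r * ENNReal.ofReal r := by
          gcongr
          exact lintegral_mono_set (Ioo_subset_Ioo (neg_le_neg hαpi) hαpi)
      _ ≤ ENNReal.ofReal ε := by rwa [mul_comm]
  have hLtop : ∫⁻ s in Ioo (-α) α, ‖c' s‖ₑ ≠ ⊤ := ne_top_of_le_ne_top ENNReal.ofReal_ne_top hL
  have hLε : (∫⁻ s in Ioo (-α) α, ‖c' s‖ₑ).toReal ≤ ε :=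
    ENNReal.toReal_le_of_le_ofReal hε.le hL
  have hab : -α < α := by linarith
  obtain ⟨a, ha⟩ := exists_tendsto_nhdsGT hab hderiv hcont hLtop
  obtain ⟨b, hb⟩ := exists_tendsto_nhdsLT hab hderiv hcont hLtop
  refine ⟨r, ⟨hr0, hr1⟩, hrε, a, b, ha, hb, fun t ht ↦ ?_, ?_⟩
  · exact (dist_le_of_tendsto hderiv hcont hLtop ha hab ht).trans hLε
  · exact (dist_le_of_tendsto_of_tendsto hderiv hcont hLtop ha hb hab).trans hLε

/-- `exists_short_crosscut` for a map with bounded image (bounded sets have finite area). [cite: PommerenkeBBCM1992, Prop. 2.2] -/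
theorem exists_short_crosscut_of_isBounded (hf : DifferentiableOn ℂ f (ball 0 1))
    (hinj : InjOn f (ball 0 1)) (hbdd : Bornology.IsBounded (f '' ball 0 1)) (hζ : ‖ζ‖ = 1)
    {ε : ℝ} (hε : 0 < ε) :
    ∃ r ∈ Ioo (0 : ℝ) 1, r ≤ ε ∧ ∃ a b : ℂ,
      Tendsto (fun t ↦ f (cpt ζ r t)) (𝓝[>] (-arccos (r / 2))) (𝓝 a) ∧
      Tendsto (fun t ↦ f (cpt ζ r t)) (𝓝[<] (arccos (r / 2))) (𝓝 b) ∧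
      (∀ t ∈ Ioo (-arccos (r / 2)) (arccos (r / 2)), dist (f (cpt ζ r t)) a ≤ ε) ∧
      dist a b ≤ ε :=
  exists_short_crosscut hf hinj hbdd.measure_lt_top.ne hζ hε

end LengthArea

end Literature.Analysis.Complex
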